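import Literature.MathematicalPhysics.QuantumFieldTheory.Balaban1983to89.Node00.CarriersB8SubDPer
import Literature.MathematicalPhysics.QuantumFieldTheory.Balaban1983to89.Node00.CarriersB8
import Literature.MathematicalPhysics.QuantumFieldTheory.Balaban1983to89.B8LeafModelZdPer
import Literature.MathematicalPhysics.QuantumFieldTheory.Balaban1983to89.B8LeafModelZd3Map

/-!
# NODE 00 (YM-PLAN Track A) — STAGE 3′(X.B8-PER): THE PERIODIC RE-PIN OF THE [Balaban1985RegularSpaces] GROUP OF RECORD — the gauge-fixing family of record READ ON THE TORUS:
# dag-n05-c's `P`-periodic member model `B8LeafModelZdPer.zdGF3Per` over this seat's periodic (1.5)-index `IdxB8SubDPer θ P` (`Node00/CarriersB8SubDPer`); the residual layer;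
# the bundle substitution `withB8OfRecordPer`; the surviving leaf `B8LeafOfRecordPer`; the Stage-5 pin `pinB8Per` (UP-SIDE); THE DOOR to the display of record `B8LeafRS` at `upOfRecord₅CS`

[Balaban1985RegularSpaces] = T. Bałaban, *Spaces of regular gauge field configurations on a lattice and gauge fixing conditions*, Commun. Math. Phys. **99** (1985) 75–102 — p. 77 «Ω_j ⊂ T_η …
we admit the case where some domains Ω_j are equal to T_η», Lemma 1 p. 79, Thm 2 p. 83, Prop. 3 p. 87, Thm 4 p. 88, Props. 5–7 pp. 94–100, Thm 8 p. 101, (1.36) p. 82, (1.62) p. 87, (1.140) p. 100.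
[Balaban1987RG1] (0.1) p. 251 (the torus).

NODE 00 CARRIER MODULE (width seat `pub-ymgap-dag-n05-w1` g3, 2026-08-28 — pen P2 of plan g86's PENS-217 for director-ym №217 (1)(c); SECOND of the pen's two modules, on top of the INDEX module
`Node00/CarriersB8SubDPer` and of pen P1's member model `B8LeafModelZdPer` (dag-n05-c g16)).  The `Node00/CarriersB8` §1–§2c pattern (node00-def g31) and this seat's `CarriersB8SubBP2D` §1–§2 pattern
VERBATIM with `I8b := IdxB8SubDPer θ P` and the periodic family; APPEND-ONLY: a NEW importing module — `CarriersB8` (`IdxB8`, `famB8OfRecord`, `ResidB8`, `pinB8`, `upOfRecord₅CS`, `B8LeafOfRecord`),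
`CarriersB8SubDPer`, `B8LeafModelZdPer` and everything below them CONSUMED BY NAME, nothing edited; no rung text touched (HARD FREEZE №216 (f)).

WHAT IS PINNED.  At a periodically pinned parameter `θ.pinB8Per P lam` the [B8] group of every run's carrier bundle IS (`PrintedCarriersR.withB8OfRecordPer`): index `I8b := IdxB8SubDPer θ P`
(periodic (1.5)-members: `Ω_l` `P`-periodic, `Lᵏ ∣ P`, `0 < P`), THE PERIODIC GAUGE-FIXING FAMILY OF RECORD `famB8OfRecordPer θ β len P j := zdGF3Per θ.𝔸 θ.L β len j.toZdIdx P` — the `P`-periodic unitary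
`θ.𝔸`-valued configurations ∕ perturbation pairs ∕ gauge transformations ∕ sources on the bonds of `ℤ^{θ.D}` with EVERY predicate `zdGF3`'s body on the underlying fields (P1's `_iff` transfer lemmas,
all `Iff.rfl`) — its `GFData2` part as `fam8`, its (1.140) ∕ `R(U₀)` predicates as the R-extension with `proj140` PROVED (`CarriersB8.proj140_famB8OfRecord` at the underlying fields); Lemma-1
carriers `blockPairNA`; `d8 := θ.D`, `L8 := θ.L`; constants, Prop-5 ∕ Prop-6 carriers and inputs from the residual layer `lam.base : ResidB8 θ` (UNCHANGED TYPE — the chain's cuts `ResidB8.cutSubBP₅ …`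
apply to it verbatim); Proposition 7's axial gauge map ON THE PERIODIC FAMILY = the layer's second field `lam.toAxial` (residual, as `ResidB8.toAxial` is for the ℤᵈ family; print's tower-wise map
on periodic data is a later pin).  Every other group of `X` unchanged (`rfl` faces); the pin is UP-SIDE (`datumOfRecord₅_pinB8Per`) and commutes with the [B10] ∕ Y ∕ Z ∕ W pins (`rfl`); it
SUPERSEDES the ℤᵈ pin (`withB8OfRecord_withB8OfRecordPer`, `rfl`).

THE DOOR (director-ym №217 (1): «periodic data ON the ℤᵈ carrier is exactly what lets the torus road conclude AT that display without re-keying a rung»).  (c₁) `upOfRecord₅CS_pinB8Per_b8_iff`: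
the `b8` leaf of the S-binding at periodically pinned Stage-5 parameters IS `B8LeafOfRecordPer θ P lam` (`Iff.rfl`).  (c₂) EQUATION-KEYED, for ANY Stage-5 parameters (in particular the Stage-13
view `θ'.toStage5₁₃CoPH F 2` of `K1V9Defs.RecordSV`, whose `res.X` is the FREE residual field — `Record13CoPH` :572–:586): `θ.res.X R = X₀.withB8OfRecordPer θ.toStage3Params P lam →
((upOfRecord₅CS F N θ R).b8 ↔ B8LeafOfRecordPer θ.toStage3Params P lam)` — N10's «`θ.res.X P = Xc.withTowerRuns10 T`» slot pattern; so NO Stage-13 pin and NO rung re-key is needed.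

HONEST FRAMING: definitions + kernel bookkeeping (`rfl` ∕ `Iff.rfl` ∕ one induction); NO estimate; nothing of [Balaban1985RegularSpaces] asserted; the leaf `B8LeafOfRecordPer` is a PROPOSITION
(N05's display over periodic members), NOT proved here; N05 NOT discharged (№217 (1)(b), (2): judged at this display with the `c₁ ∕ ρ₀` guard carried); counts unmoved; one finite T⁴ programme at
fixed ε, Bałaban AS PRINTED — NOT continuum ∕ ℝ⁴ ∕ OS ∕ mass gap ∕ Clay.  No `sorry`, no `axiom`, no `instance`, no `notation`. -/

noncomputable section

namespace Literature.MathematicalPhysics.QuantumFieldTheory.Balaban1983to89.Node00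

open T4Continuum AveragingRT T4FiniteEpsInhabited FlowStep FlowStepRuns DagBinding T4DatumAssembly
open B8LeafKnitRS (B8LeafRS)
open B8LeafModelZd (ZdIdx)
open B8LeafModelZd3 (zdGF3)
open B8LeafModelZdPer (zdGF3Per cfgZd pertZd)
open B8Lemma1NonAbelian (blockPairNA)
open scoped Matrix.Norms.L2Operator

/-! ## §1. The periodic family of record, its residual layer, the two carrier laws, the group of record and what its leaf says -/

section Bundle

variable (θ : Stage3Params)

/-- **THE PERIODIC GAUGE-FIXING FAMILY OF RECORD** over the periodic (1.5)-index: member `j ↦ zdGF3Per θ.𝔸 θ.L β len j.toZdIdx P` (dag-n05-c's WORDING, pub-ymgap bus 2026-08-28 12:56Z) —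
the `P`-periodic unitary `θ.𝔸`-valued data on the bonds of `ℤ^{θ.D}`, every predicate ∕ norm `zdGF3`'s on the underlying fields; print's theorems live on the finite torus `T_η` (p. 77).
[cite: Balaban1985RegularSpaces, p.77 («Ω_j ⊂ T_η»), (1.29) p.81, (1.33)–(1.39) p.82, (1.40) p.83, (1.62) p.87, (1.66) p.88, (1.140) p.100, (1.146) p.101] -/
def famB8OfRecordPer (β : ℝ) (len : B7Prop1Explicit.Site θ.D → ℝ) (P : ℕ) (j : IdxB8SubDPer θ P) : B8SectGH.GFData3 :=
  zdGF3Per θ.𝔸 θ.L β len j.toZdIdx P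

/-- The family unfolded at the member's `ZdIdx` (`rfl`). [cite: Balaban1985RegularSpaces, (1.29) p.81 (bookkeeping)] -/
theorem famB8OfRecordPer_eq (β : ℝ) (len : B7Prop1Explicit.Site θ.D → ℝ) (P : ℕ) (j : IdxB8SubDPer θ P) :
    famB8OfRecordPer θ β len P j = zdGF3Per θ.𝔸 θ.L β len j.1.1.1.1.1 P := rfl

/-- The family's level count is the member's depth (`rfl`). [cite: Balaban1985RegularSpaces, p.77 (bookkeeping)] -/
theorem famB8OfRecordPer_k (β : ℝ) (len : B7Prop1Explicit.Site θ.D → ℝ) (P : ℕ) (j : IdxB8SubDPer θ P) :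
    (famB8OfRecordPer θ β len P j).k = j.1.1.1.1.1.k := rfl

/-- **THE RESIDUAL LAYER of the periodic [B8] group**: the ℤᵈ layer `base : ResidB8 θ` VERBATIM (Hölder data `β, len`, Prop-5 ∕ Prop-6 carriers, inputs `B₀, B₀′`, constants `C₂, B₁′, B₁, B₂, c₁,
B₀(β₀)` — and its `toAxial` on the ℤᵈ family, NOT read here) + Proposition 7's axial gauge map ON THE PERIODIC FAMILY (residual data, no law assumed).
[cite: Balaban1985RegularSpaces, Prop. 5 p.94, Prop. 6 p.99, Prop. 7 p.100, Thm 2 p.83 («There exist constants B₁, B₂(β₀), c₁»)] -/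
structure ResidB8Per (P : ℕ) where
  /-- the ℤᵈ residual layer of `CarriersB8` (data and constants) -/
  base : ResidB8 θ
  /-- Proposition 7's axial gauge map `U′ ↦ (U′U₀ in the axial gauge of 𝔅_k relative to U₀)·U₀⁻¹` on the PERIODIC family of record -/
  toAxial : ∀ j : IdxB8SubDPer θ P, (famB8OfRecordPer θ base.β base.len P j).Cfg → (famB8OfRecordPer θ base.β base.len P j).Pert →
    (famB8OfRecordPer θ base.β base.len P j).Pert

variable {θ}

/-- **THE R-EXTENSION LAW `proj140` HOLDS ON THE PERIODIC FAMILY** — `CarriersB8.proj140_famB8OfRecord` at the underlying ℤᵈ fields (P1's predicates are `zdGF3`'s bodies on `.1`).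
[cite: Balaban1985RegularSpaces, (1.140) p.100, (1.62) p.87] -/
theorem proj140_famB8OfRecordPer (β : ℝ) (len : B7Prop1Explicit.Site θ.D → ℝ) (P : ℕ) (j : IdxB8SubDPer θ P) (α₂ : ℝ) (U₀ : (famB8OfRecordPer θ β len P j).Cfg)
    (U₁ : (famB8OfRecordPer θ β len P j).Pert) (h : (famB8OfRecordPer θ β len P j).C140 α₂ U₀ U₁) : (famB8OfRecordPer θ β len P j).C162 1 α₂ U₀ U₁ :=
  proj140_famB8OfRecord β len j.toIdxB8 α₂ (cfgZd U₀) (pertZd U₁) h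

/-- **THE CARRIER LAW (1.36) ⊂ (1.62) HOLDS ON THE PERIODIC FAMILY** (the `|A|`-member of (1.36) IS (1.62)). [cite: Balaban1985RegularSpaces, (1.36) p.82, (1.62) p.87] -/
theorem C136_C162_famB8OfRecordPer (β : ℝ) (len : B7Prop1Explicit.Site θ.D → ℝ) (P : ℕ) (j : IdxB8SubDPer θ P) (b b₂ s : ℝ) (U₀ : (famB8OfRecordPer θ β len P j).Cfg)
    (U₁ : (famB8OfRecordPer θ β len P j).Pert) (h : (famB8OfRecordPer θ β len P j).C136 b b₂ s U₀ U₁) : (famB8OfRecordPer θ β len P j).C162 b s U₀ U₁ :=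
  h.1

/-- **THE PERIODIC [B8] GROUP OF RECORD substituted into a carrier bundle** `X`: index `IdxB8SubDPer θ P`, gauge-fixing family `famB8OfRecordPer θ β len P` (its `GFData2` part as `fam8`, its
(1.140) ∕ `R(U₀)` predicates as the R-extension, `proj140` proved), Lemma-1 carriers `blockPairNA θ.D θ.L θ.𝔸`, `d8 := θ.D`, `L8 := θ.L`, Prop. 5's `B₀′ := inp.B₀′`, the other carriers and
constants from `lam.base`, the axial map `lam.toAxial`; every other group of `X` unchanged. [cite: Balaban1985RegularSpaces, Lemma 1 p.79 – Thm 8 p.101 (the carriers of the typed statements); p.77 («Ω_j ⊂ T_η»)] -/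
def _root_.Literature.MathematicalPhysics.QuantumFieldTheory.Balaban1983to89.DagBinding.PrintedCarriersR.withB8OfRecordPer (X : PrintedCarriersR)
    (θ : Stage3Params) (P : ℕ) (lam : ResidB8Per θ P) : PrintedCarriersR :=
  { X with
    I8a := B7Prop1Explicit.Site θ.D × Fin θ.D, I8b := IdxB8SubDPer θ P, I8c := lam.base.I8c, I8d := lam.base.I8d, d8 := θ.D, L8 := θ.L,
    C₂ := lam.base.C₂, B₁' := lam.base.B₁', B₀' := lam.base.inp.B₀', B₁ := lam.base.B₁, B₂ := lam.base.B₂, c₁ := lam.base.c₁, inp8 := lam.base.inp, B₀β := lam.base.B₀β,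
    loc8 := blockPairNA θ.D θ.L θ.𝔸, fam8 := fun j => (famB8OfRecordPer θ lam.base.β lam.base.len P j).toGFData2, lan8 := lam.base.lan, cub8 := lam.base.cub,
    toAxial8 := lam.toAxial,
    C140 := fun j => (famB8OfRecordPer θ lam.base.β lam.base.len P j).C140, InR := fun j => (famB8OfRecordPer θ lam.base.β lam.base.len P j).InR,
    proj140 := fun j α₂ U₀ U₁ h => proj140_famB8OfRecordPer lam.base.β lam.base.len P j α₂ U₀ U₁ h }

/-- **THE `b8` LEAF AT THE PERIODIC GROUP OF RECORD, IN ITS SURVIVING FORM** (`B8LeafKnitRS.B8LeafRS`: Lemma 1 p. 79, Thm 2 p. 83, Prop. 3 p. 87, Thm 4 p. 88, Prop. 5 p. 94, Prop. 6 p. 99,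
Prop. 7 p. 100 faithful, Thm 8 p. 101 SURVIVING at γ = 1) over the PERIODIC family of record at the residual layer `lam` — N05's display on the (β′-PERIODIC) road.  A PROPOSITION, not proved here.
[cite: Balaban1985RegularSpaces, Lemma 1 p.79, Thm 2 p.83, Prop. 3 p.87, Thm 4 p.88, Prop. 5 p.94, Prop. 6 p.99, Prop. 7 p.100, Thm 8 p.101 (surviving form, GAPS G-B8-13); p.77 («Ω_j ⊂ T_η»)] -/
def B8LeafOfRecordPer (θ : Stage3Params) (P : ℕ) (lam : ResidB8Per θ P) : Prop :=
  B8LeafRS θ.D (θ.L : ℝ) lam.base.C₂ lam.base.B₁' lam.base.inp.B₀' lam.base.B₁ lam.base.B₂ lam.base.c₁ lam.base.inp lam.base.B₀β (blockPairNA θ.D θ.L θ.𝔸)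
    (famB8OfRecordPer θ lam.base.β lam.base.len P) lam.base.lan lam.base.cub lam.toAxial

/-- The surviving leaf over the SUBSTITUTED bundle's own [B8] group IS `B8LeafOfRecordPer θ P lam` (`Iff.rfl`). [cite: Balaban1985RegularSpaces, Lemma 1 – Thm 8 pp.79–101 (bookkeeping)] -/
theorem b8LeafRS_withB8OfRecordPer_iff (X : PrintedCarriersR) (θ : Stage3Params) (P : ℕ) (lam : ResidB8Per θ P) :
    B8LeafRS (X.withB8OfRecordPer θ P lam).d8 (X.withB8OfRecordPer θ P lam).L8 (X.withB8OfRecordPer θ P lam).C₂ (X.withB8OfRecordPer θ P lam).B₁'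
        (X.withB8OfRecordPer θ P lam).B₀' (X.withB8OfRecordPer θ P lam).B₁ (X.withB8OfRecordPer θ P lam).B₂ (X.withB8OfRecordPer θ P lam).c₁ (X.withB8OfRecordPer θ P lam).inp8
        (X.withB8OfRecordPer θ P lam).B₀β (X.withB8OfRecordPer θ P lam).loc8 (X.withB8OfRecordPer θ P lam).fam8R (X.withB8OfRecordPer θ P lam).lan8
        (X.withB8OfRecordPer θ P lam).cub8 (X.withB8OfRecordPer θ P lam).toAxial8 ↔
      B8LeafOfRecordPer θ P lam :=
  Iff.rfl

/-- The substitution's index IS the periodic (1.5)-index (`rfl`). [cite: Balaban1985RegularSpaces, p.77 (bookkeeping)] -/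
theorem withB8OfRecordPer_I8b (X : PrintedCarriersR) (θ : Stage3Params) (P : ℕ) (lam : ResidB8Per θ P) : (X.withB8OfRecordPer θ P lam).I8b = IdxB8SubDPer θ P := rfl

/-- The substitution's `GFData2` family IS P1's periodic model at the members (`rfl`). [cite: Balaban1985RegularSpaces, (1.33)–(1.40) pp.82–83 (bookkeeping)] -/
theorem withB8OfRecordPer_fam8 (X : PrintedCarriersR) (θ : Stage3Params) (P : ℕ) (lam : ResidB8Per θ P) :
    (X.withB8OfRecordPer θ P lam).fam8 = fun j : IdxB8SubDPer θ P => (zdGF3Per θ.𝔸 θ.L lam.base.β lam.base.len j.1.1.1.1.1 P).toGFData2 := rfl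

/-- The substitution's re-packaged `GFData3` family `fam8R` IS the periodic family of record (`rfl`, structure eta). [cite: Balaban1985RegularSpaces, (1.33)–(1.40) pp.82–83, (1.140) p.100 (bookkeeping)] -/
theorem withB8OfRecordPer_fam8R (X : PrintedCarriersR) (θ : Stage3Params) (P : ℕ) (lam : ResidB8Per θ P) :
    (X.withB8OfRecordPer θ P lam).fam8R = famB8OfRecordPer θ lam.base.β lam.base.len P := rfl

/-- The substitution's axial map IS the layer's periodic axial map (`rfl`). [cite: Balaban1985RegularSpaces, Prop. 7 p.100 (bookkeeping)] -/
theorem withB8OfRecordPer_toAxial8 (X : PrintedCarriersR) (θ : Stage3Params) (P : ℕ) (lam : ResidB8Per θ P) : (X.withB8OfRecordPer θ P lam).toAxial8 = lam.toAxial := rfl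

/-- The substitution does not touch the [B10] group (`rfl`) … [cite: Balaban1985UV3, (1)–(5) p.256 (bookkeeping)] -/
theorem withB8OfRecordPer_runs10 (X : PrintedCarriersR) (θ : Stage3Params) (P : ℕ) (lam : ResidB8Per θ P) : (X.withB8OfRecordPer θ P lam).runs10 = X.runs10 := rfl

/-- … nor the [B12 §§2–5] group (`rfl` ×2) … [cite: Balaban1987RG1, Lemma 4 p.280 (bookkeeping)] -/
theorem withB8OfRecordPer_F12_c12 (X : PrintedCarriersR) (θ : Stage3Params) (P : ℕ) (lam : ResidB8Per θ P) :
    (X.withB8OfRecordPer θ P lam).F12 = X.F12 ∧ (X.withB8OfRecordPer θ P lam).c12 = X.c12 := ⟨rfl, rfl⟩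

/-- … nor the [B13] group (`rfl` ×2) … [cite: Balaban1988RG2Cluster, Lemmas 1–3 pp.9–20 (bookkeeping)] -/
theorem withB8OfRecordPer_S13_c13 (X : PrintedCarriersR) (θ : Stage3Params) (P : ℕ) (lam : ResidB8Per θ P) :
    (X.withB8OfRecordPer θ P lam).S13 = X.S13 ∧ (X.withB8OfRecordPer θ P lam).c13 = X.c13 := ⟨rfl, rfl⟩

/-- … commutes with the [B10] re-binding `withRuns10` (`rfl`) … [cite: Balaban1985UV3, (1)–(5) p.256 (bookkeeping)] -/
theorem withRuns10_withB8OfRecordPer (X : PrintedCarriersR) {J : Type} (r : J → B10.RunData) (θ : Stage3Params) (P : ℕ) (lam : ResidB8Per θ P) :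
    (X.withRuns10 r).withB8OfRecordPer θ P lam = (X.withB8OfRecordPer θ P lam).withRuns10 r := rfl

/-- … with the [B12] substitution `withB12` (`rfl`) … [cite: Balaban1987RG1, Lemma 4 p.280 (bookkeeping)] -/
theorem withB12_withB8OfRecordPer (X : PrintedCarriersR) (F12 : B12Sec2to5.Lemma4Frame) (c12 : B12Sec2to5.Lemma4Consts) (θ : Stage3Params) (P : ℕ) (lam : ResidB8Per θ P) :
    (X.withB12 F12 c12).withB8OfRecordPer θ P lam = (X.withB8OfRecordPer θ P lam).withB12 F12 c12 := rfl

/-- … and passes through the Stage-3 substitutions `carriers₃` (B4 ∕ B5 ∕ B6 ∕ B7 groups; `rfl`). [cite: Balaban1984PropagatorsII, pp.223–250 (bookkeeping)] -/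
theorem carriers₃_withB8OfRecordPer (θ₃ : Stage3Params) (X : PrintedCarriersR) (θ : Stage3Params) (P : ℕ) (lam : ResidB8Per θ P) :
    carriers₃ θ₃ (X.withB8OfRecordPer θ P lam) = (carriers₃ θ₃ X).withB8OfRecordPer θ P lam := rfl

/-- **THE PERIODIC PIN SUPERSEDES THE ℤᵈ PIN** (`rfl`: the same [B8] fields are overwritten). [cite: Balaban1985RegularSpaces, Lemma 1 – Thm 8 pp.79–101 (bookkeeping)] -/
theorem withB8OfRecord_withB8OfRecordPer (X : PrintedCarriersR) (θ : Stage3Params) (lam₀ : ResidB8 θ) (P : ℕ) (lam : ResidB8Per θ P) :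
    (X.withB8OfRecord θ lam₀).withB8OfRecordPer θ P lam = X.withB8OfRecordPer θ P lam := rfl

/-- Non-vacuity of the re-pin's index at every period `P > 0` with `L ∣ P` (`nonempty_idxB8SubDPer`: print's all-torus tower). [cite: Balaban1985RegularSpaces, p.77 («we admit Ω_j = T_η»; bookkeeping)] -/
theorem nonempty_I8b_withB8OfRecordPer (X : PrintedCarriersR) (θ : Stage3Params) {P : ℕ} (hP : 0 < P) (hdvd : θ.L ∣ P) (lam : ResidB8Per θ P) :
    Nonempty (X.withB8OfRecordPer θ P lam).I8b :=
  nonempty_idxB8SubDPer θ hP hdvd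

/-- The residual layer's type is inhabited (DEGENERATE inhabitant: `CarriersB8.nonempty_residB8`'s layer and the identity axial map — NOT objects of record).
[cite: Balaban1985RegularSpaces, Prop. 5 p.94, Prop. 6 p.99, Prop. 7 p.100 (bookkeeping: the residual data type)] -/
theorem nonempty_residB8Per (θ : Stage3Params) (P : ℕ) : Nonempty (ResidB8Per θ P) :=
  let ⟨lam₀⟩ := nonempty_residB8 (θ := θ)
  ⟨{ base := lam₀, toAxial := fun _ _ U => U }⟩

end Bundle

/-! ## §2. The pin on Stage-5 parameters (UP-SIDE), the S-binding at the pin, THE DOOR -/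

section Pin

variable (F : T4Family) (N : ℕ) [NeZero N]

/-- **The periodic [B8] pin of a Stage-5 residual**: every run's carrier bundle `X R` with its [B8] group := the periodic group of record at `(θ, P, lam)`; every other field unchanged.
[cite: Balaban1985RegularSpaces, Lemma 1 – Thm 8 pp.79–101 (the objects the leaf `b8` reads); p.77 («Ω_j ⊂ T_η»)] -/
def Residual₅.pinB8Per (r : Residual₅ F N) (θ : Stage3Params) (P : ℕ) (lam : ResidB8Per θ P) : Residual₅ F N :=
  { r with X := fun R => (r.X R).withB8OfRecordPer θ P lam }

/-- **The periodic [B8] pin of Stage-5 parameters** (the residual layer typed over the parameters' OWN Stage-3 dictionary). [cite: Balaban1985RegularSpaces, Thm 2 p.83 (objects of record, Stage 3′(X.B8-PER))] -/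
def Stage5Params.pinB8Per (θ : Stage5Params F N) (P : ℕ) (lam : ResidB8Per θ.toStage3Params P) : Stage5Params F N :=
  { θ with res := θ.res.pinB8Per F N θ.toStage3Params P lam }

/-- The pinned carrier family, unfolded (`rfl`). [cite: Balaban1985RegularSpaces, Lemma 1 – Thm 8 pp.79–101 (bookkeeping)] -/
theorem Stage5Params.pinB8Per_X (θ : Stage5Params F N) (P : ℕ) (lam : ResidB8Per θ.toStage3Params P) (R : B12.RunParams) :
    (θ.pinB8Per F N P lam).res.X R = (θ.res.X R).withB8OfRecordPer θ.toStage3Params P lam := rfl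

/-- The pin touches neither the Stage-3 dictionary (`rfl`) … [cite: Balaban1984PropagatorsII, pp.223–250 (bookkeeping)] -/
theorem Stage5Params.pinB8Per_toStage3Params (θ : Stage5Params F N) (P : ℕ) (lam : ResidB8Per θ.toStage3Params P) :
    (θ.pinB8Per F N P lam).toStage3Params = θ.toStage3Params := rfl

/-- … nor admissibility (`Iff.rfl`) … [cite: Balaban1983RegularityDecay, (1.6) p.572 (hypothesis dictionary; bookkeeping)] -/
theorem Stage5Params.pinB8Per_admissible_iff (θ : Stage5Params F N) (P : ℕ) (lam : ResidB8Per θ.toStage3Params P) :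
    (θ.pinB8Per F N P lam).Admissible ↔ θ.Admissible := Iff.rfl

/-- … nor the density tower (induction on `k`) … [cite: Balaban1988Convergent, (0.2) p.244 (bookkeeping)] -/
theorem densOfRecord₅_pinB8Per (θ : Stage5Params F N) (P : ℕ) (lam : ResidB8Per θ.toStage3Params P) (p : B12.RunParams) :
    ∀ k, densOfRecord₅ F N (θ.pinB8Per F N P lam) p k = densOfRecord₅ F N θ p k
  | 0 => rfl
  | k + 1 => by
    show θ.res.R p k (TrhoOfRecord F N p.K k (densOfRecord₅ F N (θ.pinB8Per F N P lam) p k)) =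
      θ.res.R p k (TrhoOfRecord F N p.K k (densOfRecord₅ F N θ p k))
    rw [densOfRecord₅_pinB8Per θ P lam p k]

/-- … nor the machine … [cite: Balaban1988Convergent, (0.2) p.244 (bookkeeping)] -/
theorem machineOfRecord₅_pinB8Per (θ : Stage5Params F N) (P : ℕ) (lam : ResidB8Per θ.toStage3Params P) :
    machineOfRecord₅ F N (θ.pinB8Per F N P lam) = machineOfRecord₅ F N θ := by
  unfold machineOfRecord₅
  simp only [densOfRecord₅_pinB8Per]
  rfl

/-- … nor the assembled datum: THE PIN IS UP-SIDE. [cite: Balaban1988Convergent, (0.2) p.244 (bookkeeping)] -/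
theorem datumOfRecord₅_pinB8Per (θ : Stage5Params F N) (P : ℕ) (lam : ResidB8Per θ.toStage3Params P) :
    datumOfRecord₅ F N (θ.pinB8Per F N P lam) = datumOfRecord₅ F N θ := by
  unfold datumOfRecord₅
  rw [machineOfRecord₅_pinB8Per]

/-- The periodic [B8] pin COMMUTES with the [B10] pin (`rfl`) … [cite: Balaban1985UV3, (1)–(5) p.256; Balaban1985RegularSpaces, Thm 2 p.83 (bookkeeping)] -/
theorem Stage5Params.pinB8Per_pinB10 (θ : Stage5Params F N) (P : ℕ) (lam : ResidB8Per θ.toStage3Params P) :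
    (θ.pinB8Per F N P lam).pinB10 F N = (θ.pinB10 F N).pinB8Per F N P lam := rfl

/-- … with the Y pin (`rfl`) … [cite: Balaban1985BackgroundPropagators, Thm 3.1 p.397 (bookkeeping)] -/
theorem Stage5Params.pinB8Per_pinY (θ : Stage5Params F N) (P : ℕ) (lam : ResidB8Per θ.toStage3Params P) (Y₀ : PrintedCarriers9X) :
    (θ.pinB8Per F N P lam).pinY F N Y₀ = (θ.pinY F N Y₀).pinB8Per F N P lam := rfl

/-- … with the Z pin (`rfl`) … [cite: Balaban1985Variational, Thm 1 p.279 (bookkeeping)] -/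
theorem Stage5Params.pinB8Per_pinZ (θ : Stage5Params F N) (P : ℕ) (lam : ResidB8Per θ.toStage3Params P) (Z₀ : PrintedCarriers11) :
    (θ.pinB8Per F N P lam).pinZ F N Z₀ = (θ.pinZ F N Z₀).pinB8Per F N P lam := rfl

/-- … with the W pin (`rfl`) … [cite: Balaban1989LargeFieldI, (0.2) p.176 (bookkeeping)] -/
theorem Stage5Params.pinB8Per_pinW (θ : Stage5Params F N) (P : ℕ) (lam : ResidB8Per θ.toStage3Params P) (W₀ : B12.RunParams → PrintedCarriers15) :
    (θ.pinB8Per F N P lam).pinW F N W₀ = (θ.pinW F N W₀).pinB8Per F N P lam := rfl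

/-- … and SUPERSEDES the ℤᵈ [B8] pin (`rfl`). [cite: Balaban1985RegularSpaces, Thm 2 p.83 (bookkeeping)] -/
theorem Stage5Params.pinB8_pinB8Per (θ : Stage5Params F N) (lam₀ : ResidB8 θ.toStage3Params) (P : ℕ) (lam : ResidB8Per θ.toStage3Params P) :
    (θ.pinB8 F N lam₀).pinB8Per F N P lam = θ.pinB8Per F N P lam := rfl

/-- The C-binding's `b9` leaf does not read the [B8] group (`rfl`; stated ALONE) … [cite: Balaban1985BackgroundPropagators, Thm 3.1 p.397 (bookkeeping)] -/
theorem upOfRecord₅C_pinB8Per_b9 (θ : Stage5Params F N) (P : ℕ) (lam : ResidB8Per θ.toStage3Params P) (R : B12.RunParams) :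
    (upOfRecord₅C F N (θ.pinB8Per F N P lam) R).b9 = (upOfRecord₅C F N θ R).b9 := rfl

/-- … nor does `b11` (`rfl`) … [cite: Balaban1985Variational, Thm 1 p.279 (bookkeeping)] -/
theorem upOfRecord₅C_pinB8Per_b11 (θ : Stage5Params F N) (P : ℕ) (lam : ResidB8Per θ.toStage3Params P) (R : B12.RunParams) :
    (upOfRecord₅C F N (θ.pinB8Per F N P lam) R).b11 = (upOfRecord₅C F N θ R).b11 := rfl

/-- … nor `rBasicStep` (`rfl`) … [cite: Balaban1989LargeFieldI, Prop. 1 p.194 (bookkeeping)] -/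
theorem upOfRecord₅C_pinB8Per_rBasicStep (θ : Stage5Params F N) (P : ℕ) (lam : ResidB8Per θ.toStage3Params P) (R : B12.RunParams) :
    (upOfRecord₅C F N (θ.pinB8Per F N P lam) R).rBasicStep = (upOfRecord₅C F N θ R).rBasicStep := rfl

/-- … nor does `b10` (the compact [B10] node reads the run family only; through `carriers₃_withB8OfRecordPer`). [cite: Balaban1985UV3, Thm 1 p.257 + Thm 2 p.272 (bookkeeping)] -/
theorem upOfRecord₅C_pinB8Per_b10_iff (θ : Stage5Params F N) (P : ℕ) (lam : ResidB8Per θ.toStage3Params P) (R : B12.RunParams) :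
    (upOfRecord₅C F N (θ.pinB8Per F N P lam) R).b10 ↔ (upOfRecord₅C F N θ R).b10 := by
  rw [upOfRecord₅C_b10_iff, upOfRecord₅C_b10_iff, Stage5Params.pinB8Per_toStage3Params, Stage5Params.pinB8Per_X, carriers₃_withB8OfRecordPer]
  exact Iff.rfl

/-- ★★★ **THE DOOR (c₁): THE `b8` LEAF OF THE S-BINDING AT PERIODICALLY PINNED PARAMETERS IS THE SURVIVING LEAF AT THE PERIODIC GROUP OF RECORD** (`Iff.rfl` through
`carriers₃_withB8OfRecordPer`) — N05's display `B8LeafRS` at `upOfRecord₅CS`, read with periodic data, by name. [cite: Balaban1985RegularSpaces, Lemma 1 – Thm 8 pp.79–101 (the leaf at the objects of record); p.77 («Ω_j ⊂ T_η»)] -/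
theorem upOfRecord₅CS_pinB8Per_b8_iff (θ : Stage5Params F N) (P : ℕ) (lam : ResidB8Per θ.toStage3Params P) (R : B12.RunParams) :
    (upOfRecord₅CS F N (θ.pinB8Per F N P lam) R).b8 ↔ B8LeafOfRecordPer θ.toStage3Params P lam :=
  Iff.rfl

/-- **The S-binding's `b8` leaf at ANY parameters, keyed by the run's carrier bundle**: if `θ.res.X R = Y` then the leaf IS `B8LeafRS` over `carriers₃ θ.toStage3Params Y`'s [B8] group
(`subst`; the form through which a record whose residual `X` is free — the Stage-13 view `toStage5₁₃CoPH` — meets any [B8] substitution). [cite: Balaban1985RegularSpaces, Lemma 1 – Thm 8 pp.79–101 (bookkeeping)] -/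
theorem upOfRecord₅CS_b8_iff_of_res_X_eq' (θ : Stage5Params F N) (R : B12.RunParams) {Y : PrintedCarriersR} (hX : θ.res.X R = Y) :
    (upOfRecord₅CS F N θ R).b8 ↔
      B8LeafRS (carriers₃ θ.toStage3Params Y).d8 (carriers₃ θ.toStage3Params Y).L8 (carriers₃ θ.toStage3Params Y).C₂ (carriers₃ θ.toStage3Params Y).B₁'
        (carriers₃ θ.toStage3Params Y).B₀' (carriers₃ θ.toStage3Params Y).B₁ (carriers₃ θ.toStage3Params Y).B₂ (carriers₃ θ.toStage3Params Y).c₁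
        (carriers₃ θ.toStage3Params Y).inp8 (carriers₃ θ.toStage3Params Y).B₀β (carriers₃ θ.toStage3Params Y).loc8 (carriers₃ θ.toStage3Params Y).fam8R
        (carriers₃ θ.toStage3Params Y).lan8 (carriers₃ θ.toStage3Params Y).cub8 (carriers₃ θ.toStage3Params Y).toAxial8 := by
  subst hX
  exact Iff.rfl

/-- ★★ **THE DOOR (c₂), EQUATION-KEYED — FOR ANY STAGE-5 PARAMETERS WHOSE RUN-`R` CARRIER BUNDLE IS A PERIODICALLY SUBSTITUTED ONE** (in particular the Stage-13 view
`θ'.toStage5₁₃CoPH F 2` of `K1V9Defs.RecordSV`, whose `res.X` is the free residual field): the S-binding's `b8` leaf IS `B8LeafOfRecordPer` — so the K1 witness reaches N05's display with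
periodic data WITHOUT a Stage-13 pin and WITHOUT re-keying a rung (director-ym №217 (1)). [cite: Balaban1985RegularSpaces, Lemma 1 – Thm 8 pp.79–101 (the leaf at the objects of record); p.77] -/
theorem upOfRecord₅CS_b8_iff_of_res_X_eq (θ : Stage5Params F N) (R : B12.RunParams) (X₀ : PrintedCarriersR) (P : ℕ) (lam : ResidB8Per θ.toStage3Params P)
    (hX : θ.res.X R = X₀.withB8OfRecordPer θ.toStage3Params P lam) :
    (upOfRecord₅CS F N θ R).b8 ↔ B8LeafOfRecordPer θ.toStage3Params P lam :=
  upOfRecord₅CS_b8_iff_of_res_X_eq' F N θ R hX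

/-- At periodically pinned parameters the carrier law (1.36) ⊂ (1.62) HOLDS (periodic family of record), so OLD ⇒ NEW (`upOfRecord₅C` leaf AS TYPED ⇒ the S-binding's) is unconditional there.
[cite: Balaban1985RegularSpaces, (1.36) p.82, (1.62) p.87, Thm 8 p.101 (bookkeeping)] -/
theorem upOfRecord₅CS_pinB8Per_b8_of_b8 (θ : Stage5Params F N) (P : ℕ) (lam : ResidB8Per θ.toStage3Params P) (R : B12.RunParams)
    (h : (upOfRecord₅C F N (θ.pinB8Per F N P lam) R).b8) : (upOfRecord₅CS F N (θ.pinB8Per F N P lam) R).b8 :=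
  upOfRecord₅CS_b8_of_upOfRecord₅C_b8 F N _ R (fun j b b₂ s U₀ U₁ h' => C136_C162_famB8OfRecordPer lam.base.β lam.base.len P j b b₂ s U₀ U₁ h') h

end Pin

/-! ## §3. Sub-family readiness: the surviving leaf at the periodic group passes to every re-indexing (the `CarriersB8` §2c pattern) -/

section SubFamily

variable {θ : Stage3Params} {P : ℕ}

/-- **THE SURVIVING LEAF PASSES TO SUB-FAMILIES** (pure logic, conjunct by conjunct, BY NAME): for every re-indexing `e : J → IdxB8SubDPer θ P` the leaf at the periodic group of record gives
the leaf over `famB8OfRecordPer θ β len P ∘ e` with the restricted axial map. [cite: Balaban1985RegularSpaces, Lemma 1 – Thm 8 pp.79–101 (bookkeeping: restriction of the family index)] -/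
theorem b8LeafOfRecordPer_precomp {J : Type} (e : J → IdxB8SubDPer θ P) (lam : ResidB8Per θ P) (h : B8LeafOfRecordPer θ P lam) :
    B8LeafRS θ.D (θ.L : ℝ) lam.base.C₂ lam.base.B₁' lam.base.inp.B₀' lam.base.B₁ lam.base.B₂ lam.base.c₁ lam.base.inp lam.base.B₀β (blockPairNA θ.D θ.L θ.𝔸)
      (fun j => famB8OfRecordPer θ lam.base.β lam.base.len P (e j)) lam.base.lan lam.base.cub (fun j => lam.toAxial (e j)) where
  l1 := h.l1
  t2 := B8LeafKnit.thm2Printed_precomp e (fun j => (famB8OfRecordPer θ lam.base.β lam.base.len P j).toGFData) h.t2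
  p3 := B8LeafKnit.prop3Printed_precomp e θ.D (θ.L : ℝ) lam.base.C₂ lam.base.inp lam.base.B₀β (fun j => (famB8OfRecordPer θ lam.base.β lam.base.len P j).toGFData2) h.p3
  t4 := B8LeafKnit.thm4Printed_precomp e lam.base.B₁' (fun j => (famB8OfRecordPer θ lam.base.β lam.base.len P j).toGFData) h.t4
  p5e := h.p5e
  p5u := h.p5u
  p6 := h.p6
  p7 := B8LeafKnit.prop7PrintedR_precomp e (famB8OfRecordPer θ lam.base.β lam.base.len P) lam.toAxial h.p7
  t8 := B8Thm8Surviving.thm8SurvivingAt_precomp e 1 lam.base.B₁ lam.base.B₂ (famB8OfRecordPer θ lam.base.β lam.base.len P) h.t8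

/-- In particular for a SUB-INDEX cut out by a predicate `Q` on the periodic index. [cite: Balaban1985RegularSpaces, Lemma 1 – Thm 8 pp.79–101 (bookkeeping: restriction of the family index)] -/
theorem b8LeafOfRecordPer_subtype (Q : IdxB8SubDPer θ P → Prop) (lam : ResidB8Per θ P) (h : B8LeafOfRecordPer θ P lam) :
    B8LeafRS θ.D (θ.L : ℝ) lam.base.C₂ lam.base.B₁' lam.base.inp.B₀' lam.base.B₁ lam.base.B₂ lam.base.c₁ lam.base.inp lam.base.B₀β (blockPairNA θ.D θ.L θ.𝔸)
      (fun j : {i : IdxB8SubDPer θ P // Q i} => famB8OfRecordPer θ lam.base.β lam.base.len P j.1) lam.base.lan lam.base.cub (fun j => lam.toAxial j.1) :=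
  b8LeafOfRecordPer_precomp (fun j : {i : IdxB8SubDPer θ P // Q i} => j.1) lam h

/-- The projections the chain reads: Theorem 2's conjunct over the periodic family (the box-form (1.66)₁ reading of `CarriersB8` §2d, R453 (B), applies verbatim — same field `avgClose`).
[cite: Balaban1985RegularSpaces, Thm 2 p.83, (1.35) p.82, (1.65)–(1.66) pp.87–88] -/
theorem b8LeafOfRecordPer_t2 (lam : ResidB8Per θ P) (h : B8LeafOfRecordPer θ P lam) :
    B8.Thm2Printed (fun j : IdxB8SubDPer θ P => (famB8OfRecordPer θ lam.base.β lam.base.len P j).toGFData) :=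
  h.t2

/-- **THE LEAF's PROPOSITION-3 CONJUNCT AT THE PERIODIC GROUP FOLLOWS FROM THE ℤᵈ GROUP's** (Proposition 3 is a pure-∀ sentence; P1's `prop3Printed_per_of_zd` ∘ `B8LeafKnit.prop3Printed_precomp`
along `toIdxB8` — BY NAME). [cite: Balaban1985RegularSpaces, Prop. 3 p.87] -/
theorem b8LeafOfRecordPer_p3_of_zd (lam : ResidB8Per θ P) (h : B8LeafOfRecord θ lam.base) :
    B8.Prop3Printed θ.D (θ.L : ℝ) lam.base.C₂ lam.base.inp lam.base.B₀β (fun j : IdxB8SubDPer θ P => (famB8OfRecordPer θ lam.base.β lam.base.len P j).toGFData2) :=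
  B8LeafModelZdPer.prop3Printed_per_of_zd (fun j : IdxB8SubDPer θ P => j.toZdIdx) (fun _ => P)
    (B8LeafKnit.prop3Printed_precomp (fun j : IdxB8SubDPer θ P => j.toIdxB8) θ.D (θ.L : ℝ) lam.base.C₂ lam.base.inp lam.base.B₀β
      (fun i => (famB8OfRecord θ lam.base.β lam.base.len i).toGFData2) h.p3)

/-- **PROPOSITION 3 AT THE PERIODIC FAMILY OF RECORD**, modulo the [Balaban1985BackgroundPropagators]-Thm-3.3 socket `SockB9P3` AT THE PERIODIC MEMBERS ONLY (dag-n05-w2's P5 NIT-1: on the (β′) road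
N06's objects exist on the periodic side only — n05-a's `B8LeafModelZd3Map.prop3Printed_zd3_map` «socket on the image of ι», carried by P1's `prop3Printed_per_of_zd`): for `θ.D ≥ 2`, `C₂ ≥ 2097152(d+1)²`, `B₀(β₀) ≥ 0`.
[cite: Balaban1985RegularSpaces, Prop. 3 p.87, (1.36)–(1.40) pp.82–83; Balaban1985BackgroundPropagators, Thm 3.3 p.399] -/
theorem prop3_famB8OfRecordPer (hD : 2 ≤ θ.D) (inp : B8.B9Inputs) {B₀β C₂ cP : ℝ} (hB₀β : 0 ≤ B₀β) (hC₂ : 2097152 * ((θ.D : ℝ) + 1) ^ 2 ≤ C₂) (hcP : 0 < cP)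
    (β : ℝ) (len : B7Prop1Explicit.Site θ.D → ℝ)
    (SB9 : ∀ j : IdxB8SubDPer θ P, B8LeafModelZd3.SockB9P3 (𝔸 := θ.𝔸) θ.L inp.B₀ B₀β cP β len j.toZdIdx.η j.toZdIdx.k j.toZdIdx.Ω j.toZdIdx.Λs j.toZdIdx.Λb) :
    B8.Prop3Printed θ.D (θ.L : ℝ) C₂ inp B₀β (fun j : IdxB8SubDPer θ P => (famB8OfRecordPer θ β len P j).toGFData2) :=
  B8LeafModelZdPer.prop3Printed_per_of_zd (fun j : IdxB8SubDPer θ P => j.toZdIdx) (fun _ => P)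
    (B8LeafModelZd3Map.prop3Printed_zd3_map hD θ.two_le_L inp hB₀β hC₂ hcP β len (fun j : IdxB8SubDPer θ P => j.toZdIdx) SB9)

end SubFamily

end Literature.MathematicalPhysics.QuantumFieldTheory.Balaban1983to89.Node00

end
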